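import Summits.NavierStokesRegularity.FluidComputer.ClayBlowupLocalAxisDecay
import Summits.NavierStokesRegularity.FluidComputer.ClayBlowupSwirlBound
import HarnessLib

/-!
# LOCAL KNSS 6.1 WITH THE CLAY FORCE, POLOIDAL FORM: near every singular point of an axisymmetric
# Clay blow-up the scale-invariant bound `|x'| ‖ū‖ ≤ C` fails for the MERIDIONAL part `ū` alone

Cell `ns-blowup`, seat `ns-blowup-ecbridge-2` (g12; the E–C endpoint theory seat). LABEL: E–C typing
(KERNEL — no named fact, no new definition). WHAT THIS IS NOT: not Navier–Stokes evidence — a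
necessary condition on the TYPE `ClayBlowup ν`; no inhabitant is claimed. Companion memo:
`run/shared/lean/pub/ns-blowup/ecbridge2/ECBRIDGE-2-MEMO-11.md`.

Seregin–Šverák (Comm. PDE 34 (2009) = arXiv:0804.1803, §1 (1.2), Thm 1.2) place the bound
`|x'| |v̄| ≤ C` on the meridional (poloidal) projection `v̄` only; the swirl is controlled by the
maximum principle for `Γ = r u_θ`. g11's local KNSS 6.1 with force
(`not_local_cylRadius_mul_norm_le_of_isAxisymmetric`) carries the bound on the FULL velocity. For a
Clay blow-up with axisymmetric datum and Clay force the two are equivalent: the forced swirl maximum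
principle (`ClayBlowup.swirl_bounded`, g8) gives `|Γ| ≤ C_Γ` on `[0, T) × ℝ³`, and
`|x'|‖u‖ ≤ |x'|‖ū‖ + |Γ|` pointwise (`cylRadius_mul_norm_le_poloidal_add_abs_swirl`).

* `ClayBlowup.not_local_cylRadius_mul_poloidal_norm_le_of_isAxisymmetric` — at a point `x₁` which
  is not backward bounded, NO bound `|x'| ‖poloidalPart (u t) x‖ ≤ C` on any `(t₀, T) × B(x₁, r₀)`;
  kill form `exists_local_cylRadius_mul_poloidal_norm_gt`; `DesignedBlowup` twin.

References: Seregin–Šverák 2009, (1.2) and Thm 1.2 [cite: SereginSverak2009, Thm 1.2];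
Koch–Nadirashvili–Seregin–Šverák, Acta Math. 203 (2009), Thm 6.1 [cite: KochNadirashviliSereginSverak2009, Thm 6.1].
-/

noncomputable section

namespace Summit.NavierStokesRegularity.FluidComputer

open Set MeasureTheory Filter Topology Function Metric
open scoped ENNReal NNReal
open Literature.Analysis Literature.Analysis.FluidPDE
open Summit.NavierStokesRegularity.NavierStokesRegularity

namespace ClayBlowup

variable {ν : ℝ} (X : ClayBlowup ν)

/-- **LOCAL KNSS 6.1 WITH THE CLAY FORCE, POLOIDAL FORM** (`ν > 0`; axisymmetric datum and Clay force;
no named fact): at a point `x₁` which is not backward bounded at `T`, for every `r₀ > 0` and `t₀ < T`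
there is NO `C` with `|x'| ‖ū(t, x)‖ ≤ C` on `(t₀, T) × B(x₁, r₀)`, `ū = poloidalPart (u t)` the
meridional part: such a bound plus the swirl maximum principle `|r u_θ| ≤ C_Γ` would bound `|x'|‖u‖`
by `C + C_Γ` near `x₁`, against g11's local KNSS 6.1. [cite: SereginSverak2009, Thm 1.2]
[cite: KochNadirashviliSereginSverak2009, Thm 6.1] -/
theorem not_local_cylRadius_mul_poloidal_norm_le_of_isAxisymmetric (hν : 0 < ν)
    (h0A : IsAxisymmetric (X.u 0)) (hfA : ∀ t ∈ Ico 0 X.T, IsAxisymmetric (X.f t))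
    {x₁ : EuclideanSpace ℝ (Fin 3)} (hx₁ : ¬ IsBackwardBoundedAt X.u X.T x₁) {r₀ : ℝ} (hr₀ : 0 < r₀)
    {t₀ : ℝ} (ht₀ : t₀ < X.T) :
    ¬ ∃ C : ℝ, ∀ t ∈ Ioo t₀ X.T, ∀ x ∈ ball x₁ r₀,
      cylRadius x * ‖poloidalPart (X.u t) x‖ ≤ C := by
  rintro ⟨C, hC⟩
  have hT := X.T_pos
  obtain ⟨CΓ, -, hΓ⟩ := X.swirl_bounded hν h0A hfA
  have ht₀' : max t₀ 0 < X.T := max_lt ht₀ hT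
  refine X.not_local_cylRadius_mul_norm_le_of_isAxisymmetric hν h0A hfA hx₁ hr₀ ht₀'
    ⟨C + CΓ, fun t ht x hx => ?_⟩
  have ht0 : t ∈ Ico 0 X.T := ⟨(le_max_right t₀ 0).trans ht.1.le, ht.2⟩
  have ht1 : t ∈ Ioo t₀ X.T := ⟨lt_of_le_of_lt (le_max_left t₀ 0) ht.1, ht.2⟩
  calc cylRadius x * ‖X.u t x‖
      ≤ cylRadius x * ‖poloidalPart (X.u t) x‖ + |swirl (X.u t) x| :=
        cylRadius_mul_norm_le_poloidal_add_abs_swirl (X.u t) x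
    _ ≤ C + CΓ := add_le_add (hC t ht1 x hx) (hΓ t ht0 x)

/-- **Kill form**: `|x'| ‖ū‖` exceeds every `C` inside every `(t₀, T) × B(x₁, r₀)` around every
singular point of an axisymmetric Clay blow-up, with its force. [cite: SereginSverak2009, Thm 1.2] -/
theorem exists_local_cylRadius_mul_poloidal_norm_gt (hν : 0 < ν) (h0A : IsAxisymmetric (X.u 0))
    (hfA : ∀ t ∈ Ico 0 X.T, IsAxisymmetric (X.f t)) {x₁ : EuclideanSpace ℝ (Fin 3)}
    (hx₁ : ¬ IsBackwardBoundedAt X.u X.T x₁) {r₀ : ℝ} (hr₀ : 0 < r₀) {t₀ : ℝ} (ht₀ : t₀ < X.T)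
    (C : ℝ) :
    ∃ t ∈ Ioo t₀ X.T, ∃ x ∈ ball x₁ r₀, C < cylRadius x * ‖poloidalPart (X.u t) x‖ := by
  by_contra hcon
  push Not at hcon
  exact X.not_local_cylRadius_mul_poloidal_norm_le_of_isAxisymmetric hν h0A hfA hx₁ hr₀ ht₀ ⟨C, hcon⟩

end ClayBlowup

/-- **Local KNSS 6.1 with the force, poloidal form, for designed blow-ups.**
[cite: SereginSverak2009, Thm 1.2] -/
theorem DesignedBlowup.exists_local_cylRadius_mul_poloidal_norm_gt {ν : ℝ} (D : DesignedBlowup ν)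
    (hν : 0 < ν) (h0A : IsAxisymmetric (D.u 0)) (hfA : ∀ t ∈ Ico 0 D.T, IsAxisymmetric (D.f t))
    {x₁ : EuclideanSpace ℝ (Fin 3)} (hx₁ : ¬ IsBackwardBoundedAt D.u D.T x₁) {r₀ : ℝ} (hr₀ : 0 < r₀)
    {t₀ : ℝ} (ht₀ : t₀ < D.T) (C : ℝ) :
    ∃ t ∈ Ioo t₀ D.T, ∃ x ∈ ball x₁ r₀, C < cylRadius x * ‖poloidalPart (D.u t) x‖ :=
  D.toClayBlowup.exists_local_cylRadius_mul_poloidal_norm_gt hν h0A hfA hx₁ hr₀ ht₀ C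

end Summit.NavierStokesRegularity.FluidComputer

end
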